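import Mathlib.RingTheory.IntegralDomain
import Mathlib.LinearAlgebra.FiniteDimensional.Lemmas
import Literature.NumberTheory.GaloisRepresentations.ProjectiveType
import Literature.NumberTheory.GaloisRepresentations.DihedralGroupRecognition
import HarnessLib

/-!
# Solvable irreducible subgroups of `GL₂` in characteristic `2` are of dihedral type

Topic `Literature/NumberTheory/GaloisRepresentations` (vocabulary of `ProjectiveType.lean`:
`projectiveImage`, `IsDihedralType`, `toStdRepresentation`, `eigenvectorStabilizer`).  A pure
proof file (theorems only, no definition, no named fact; D-0026) formalizing

* **Khare–Wintenberger, *Serre's modularity conjecture (I)*, Invent. Math. 178 (2009),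
  Lemma 6.1**: *Let `G` be a finite, solvable subgroup of `GL₂(𝔽̄₂)` which acts irreducibly on
  `𝔽̄₂²`.  Then the projective image of `G` is dihedral.*

(`KhareWintenberger2009.lemma_6_1` below), one of the "utilitarian lemmas" of §6 of the proof of
Serre's conjecture (`Literature.NumberTheory.Automorphic.khare_wintenberger`), used there in
Lemma 6.2 (i) (modularity of `S`-type representations with solvable image, `p = 2`) and §9.

Khare–Wintenberger deduce it from Dickson's classification of the finite irreducible subgroups
of `PGL₂(𝔽̄_p)` (their [10], II.8.27), ruling out `A₄` and `S₄`.  Dickson's theorem is in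
neither Mathlib nor `Literature/` (the tree only has Klein's theorem over `ℂ`, as the named fact
`klein_finite_subgroup_pgl_two`), so this file gives a **direct proof**, valid over every
algebraically closed field `k` of characteristic `2` (`𝔽̄₂` being one):

1. In characteristic `2` a scalar `2 × 2` matrix of determinant `1` is the identity (`λ² = 1`
   forces `λ = 1`), so two elements of `GL₂(k)` whose commutator is central commute
   (`commute_of_commutator_mem_center`).
2. Let `Γ ≤ GL₂(k)` be finite, solvable, without a common eigenline.  The last term `N` of the
   derived series of `Γ` not consisting of scalars has `[N, N]` scalar, hence (1.) `N` is an
   abelian normal subgroup of `Γ` containing a non-scalar `x₀`.  An eigenvector `v` of `x₀` spans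
   its whole eigenspace, so `v` is a common eigenvector of `N`; `Γ` permutes the common eigenlines
   of `N` (normality), and an `h₀ ∈ Γ` moving `kv` gives a second one `kw`, `w = h₀ v`, on which
   `x₀` has a different eigenvalue; hence every `g ∈ Γ` either preserves both lines `kv`, `kw` or
   swaps them (`Γ` is monomial).
3. The line-preserving part `D` maps to `kˣ` by the ratio of its two eigenvalues, with scalar
   kernel; its image is a finite subgroup of `kˣ`, hence cyclic, so the projective image `Ā` of `D`
   is cyclic, generated by some `ā`.  Every line-swapping `g` has `g²` scalar, and the product of
   two line-swapping elements preserves the lines.  So the projective image of `Γ` is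
   `Ā ∪ s̄Ā` with `s̄² = 1`, `s̄ ā s̄⁻¹ = ā⁻¹`, `s̄ ∉ Ā`, i.e. dihedral `D_m`, `m = ord ā`
   (`nonempty_mulEquiv_dihedralGroup` of `DihedralGroupRecognition.lean`), and `m ≥ 2` because
   `x̄₀ ≠ 1` lies in `Ā`.

Main statements: `exists_mulEquiv_dihedralGroup_of_isSolvable_charTwo` (subgroups of `GL₂(k)`
without common eigenline), `isDihedralType_of_isSolvable_charTwo` (homomorphisms
`ρ : G →* GL₂(k)` with finite solvable image and irreducible standard representation) and
`KhareWintenberger2009.lemma_6_1` (the printed form).  In odd characteristic step 1 fails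
(`λ = −1`: the quaternion group in `SL₂`) and `A₄`, `S₄` do occur.

## References

* C. Khare, J.-P. Wintenberger, *Serre's modularity conjecture (I)*, Invent. Math. 178 (2009),
  485–504, §6, Lemma 6.1. [KhareWintenberger2009]
-/

open scoped MatrixGroups Matrix

namespace Literature.NumberTheory.GaloisRepresentations

namespace SolvableCharTwo

variable {k : Type*} [Field k]

/-! ### Two-dimensional linear algebra along a basis `v, w` -/

/-- Two `2 × 2` matrices agreeing on a basis `v, w` of `k²` are equal. [folklore] -/
theorem matrix_eq_of_mulVec_eq {v w : Fin 2 → k} (hvw : LinearIndependent k ![v, w])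
    {M N : Matrix (Fin 2) (Fin 2) k} (h0 : M *ᵥ v = N *ᵥ v) (h1 : M *ᵥ w = N *ᵥ w) :
    M = N := by
  classical
  let b := basisOfPiSpaceOfLinearIndependent hvw
  apply Matrix.toLin'.injective
  refine b.ext fun i => ?_
  fin_cases i
  · simp [b, Matrix.toLin'_apply, h0]
  · simp [b, Matrix.toLin'_apply, h1]

/-- Coordinates of a vector along a basis `v, w` of `k²`. [folklore] -/
theorem exists_eq_smul_add_smul {v w : Fin 2 → k} (hvw : LinearIndependent k ![v, w])
    (u : Fin 2 → k) : ∃ α β : k, u = α • v + β • w := by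
  classical
  let b := basisOfPiSpaceOfLinearIndependent hvw
  refine ⟨b.repr u 0, b.repr u 1, ?_⟩
  conv_lhs => rw [← b.sum_repr u]
  simp [b, Fin.sum_univ_two]

/-- An eigenvector of a matrix acting diagonally on the basis `v, w` with two different
eigenvalues lies on one of the two axes. [folklore] -/
theorem mem_line_or_of_eigenvector {v w : Fin 2 → k} (hvw : LinearIndependent k ![v, w])
    {M : Matrix (Fin 2) (Fin 2) k} {c c' : k} (hMv : M *ᵥ v = c • v) (hMw : M *ᵥ w = c' • w)
    (hcc : c ≠ c') {u : Fin 2 → k} {μ : k} (hMu : M *ᵥ u = μ • u) :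
    (∃ α : k, u = α • v) ∨ ∃ β : k, u = β • w := by
  obtain ⟨α, β, rfl⟩ := exists_eq_smul_add_smul hvw u
  have h1 : M *ᵥ (α • v + β • w) = (α * c) • v + (β * c') • w := by
    rw [Matrix.mulVec_add, Matrix.mulVec_smul, Matrix.mulVec_smul, hMv, hMw, smul_smul, smul_smul]
  have h2 : μ • (α • v + β • w) = (μ * α) • v + (μ * β) • w := by
    rw [smul_add, smul_smul, smul_smul]
  have hE : (α * c) • v + (β * c') • w = (μ * α) • v + (μ * β) • w := h1.symm.trans (hMu.trans h2)
  have h3 := LinearIndependent.pair_iff.mp hvw (α * c - μ * α) (β * c' - μ * β)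
    (by rw [sub_smul, sub_smul, sub_add_sub_comm, sub_eq_zero]; exact hE)
  by_cases hα : α = 0
  · exact Or.inr ⟨β, by rw [hα, zero_smul, zero_add]⟩
  · have hμ : μ = c := by
      have : α * (c - μ) = 0 := by linear_combination h3.1
      rcases mul_eq_zero.mp this with h | h
      · exact absurd h hα
      · exact (sub_eq_zero.mp h).symm
    have hβ : β = 0 := by
      have : β * (c' - c) = 0 := by linear_combination h3.2 + β * hμ
      rcases mul_eq_zero.mp this with h | h
      · exact h
      · exact absurd (sub_eq_zero.mp h).symm hcc
    exact Or.inl ⟨α, by rw [hβ, zero_smul, add_zero]⟩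

/-- A non-zero vector and a vector off its line are linearly independent. [folklore] -/
theorem linearIndependent_pair_of_not_mem_line {v u : Fin 2 → k} (hv : v ≠ 0)
    (hu : ¬∃ α : k, u = α • v) : LinearIndependent k ![v, u] := by
  rw [LinearIndependent.pair_iff]
  intro s t hst
  by_cases ht : t = 0
  · subst ht
    simp only [zero_smul, add_zero] at hst
    exact ⟨(smul_eq_zero.mp hst).resolve_right hv, rfl⟩
  · exfalso
    apply hu
    refine ⟨-(s / t), ?_⟩
    have h1 : t • u = -(s • v) := eq_neg_of_add_eq_zero_right hst
    calc u = t⁻¹ • (t • u) := by rw [smul_smul, inv_mul_cancel₀ ht, one_smul]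
      _ = -(s / t) • v := by rw [h1, smul_neg, smul_smul, neg_smul, div_eq_inv_mul]

/-- Two multiples of one vector are never linearly independent. [folklore] -/
theorem not_linearIndependent_pair_smul_smul (v : Fin 2 → k) (α α' : k) :
    ¬LinearIndependent k ![α • v, α' • v] := by
  intro h
  have h0 : α • v ≠ 0 := by simpa using h.ne_zero 0
  have hlin : α' • (α • v) + (-α) • (α' • v) = 0 := by
    have : α' * α + -α * α' = 0 := by ring
    rw [smul_smul, smul_smul, ← add_smul, this, zero_smul]
  have := (LinearIndependent.pair_iff.mp h α' (-α) hlin).2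
  rw [neg_eq_zero] at this
  exact h0 (by rw [this, zero_smul])

/-- `g⁻¹ (g x) = x` for `g ∈ GL_n(k)` acting on column vectors. [folklore] -/
@[simp] theorem inv_mulVec_mulVec {n : Type*} [Fintype n] [DecidableEq n] (g : GL n k)
    (x : n → k) :
    ((g⁻¹ : GL n k) : Matrix n n k) *ᵥ (((g : GL n k) : Matrix n n k) *ᵥ x) = x := by
  rw [Matrix.mulVec_mulVec, ← Matrix.GeneralLinearGroup.coe_mul, inv_mul_cancel,
    Matrix.GeneralLinearGroup.coe_one, Matrix.one_mulVec]

/-- An invertible matrix maps a basis `v, w` to a linearly independent pair. [folklore] -/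
theorem linearIndependent_pair_mulVec {v w : Fin 2 → k} (hvw : LinearIndependent k ![v, w])
    (g : GL (Fin 2) k) :
    LinearIndependent k ![(g : Matrix (Fin 2) (Fin 2) k) *ᵥ v, (g : Matrix (Fin 2) (Fin 2) k) *ᵥ w] := by
  rw [LinearIndependent.pair_iff] at hvw ⊢
  intro s t hst
  apply hvw s t
  have h : (g : Matrix (Fin 2) (Fin 2) k) *ᵥ (s • v + t • w) = 0 := by
    rw [Matrix.mulVec_add, Matrix.mulVec_smul, Matrix.mulVec_smul, hst]
  have := congrArg (fun x => ((g⁻¹ : GL (Fin 2) k) : Matrix (Fin 2) (Fin 2) k) *ᵥ x) h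
  simpa using this

/-- A `g ∈ GL₂(k)` acting by the same scalar on a basis `v, w` is central. [folklore] -/
theorem mem_center_of_mulVec_eq_smul {v w : Fin 2 → k} (hvw : LinearIndependent k ![v, w])
    {g : GL (Fin 2) k} {c : k} (h0 : (g : Matrix (Fin 2) (Fin 2) k) *ᵥ v = c • v)
    (h1 : (g : Matrix (Fin 2) (Fin 2) k) *ᵥ w = c • w) :
    g ∈ Subgroup.center (GL (Fin 2) k) := by
  have hg : (g : Matrix (Fin 2) (Fin 2) k) = c • (1 : Matrix (Fin 2) (Fin 2) k) :=
    matrix_eq_of_mulVec_eq hvw (by rw [h0, Matrix.smul_mulVec, Matrix.one_mulVec])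
      (by rw [h1, Matrix.smul_mulVec, Matrix.one_mulVec])
  rw [Matrix.GeneralLinearGroup.mem_center_iff_val_mem_range_scalar]
  exact ⟨c, by rw [hg, Matrix.scalar_apply, Matrix.smul_one_eq_diagonal]⟩

/-! ### Eigenvalues of invertible matrices -/

/-- An invertible matrix has non-zero eigenvalue on a non-zero eigenvector. [folklore] -/
theorem eigenvalue_ne_zero {n : Type*} [Fintype n] [DecidableEq n] {v : n → k} (hv : v ≠ 0)
    {g : GL n k} {a : k} (h : (g : Matrix n n k) *ᵥ v = a • v) : a ≠ 0 := by
  rintro rfl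
  rw [zero_smul] at h
  apply hv
  have := congrArg (fun x => ((g⁻¹ : GL n k) : Matrix n n k) *ᵥ x) h
  simpa using this

/-! ### Irreducibility: no common eigenline -/

/-- If every `ρ g` has `v ≠ 0` as an eigenvector, the standard representation is reducible
(the line `kv` is invariant); contrapositive form. [folklore] -/
theorem exists_not_mem_eigenvectorStabilizer {G : Type*} [Group G] (ρ : G →* GL (Fin 2) k)
    (hirr : (toStdRepresentation ρ).IsIrreducible) (v : Fin 2 → k) (hv : v ≠ 0) :
    ∃ g : G, ρ g ∉ eigenvectorStabilizer v hv := by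
  by_contra hall
  push Not at hall
  let S : Subrepresentation (toStdRepresentation ρ) :=
    { toSubmodule := k ∙ v
      apply_mem_toSubmodule := by
        intro g w hw
        obtain ⟨b, rfl⟩ := Submodule.mem_span_singleton.mp hw
        obtain ⟨a, ha⟩ := mem_eigenvectorStabilizer_iff.mp (hall g)
        rw [toStdRepresentation_apply_apply, Matrix.mulVec_smul, ha, smul_smul]
        exact Submodule.mem_span_singleton.mpr ⟨b * a, rfl⟩ }
  rcases IsSimpleOrder.eq_bot_or_eq_top (α := Subrepresentation (toStdRepresentation ρ)) S with
    hS | hS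
  · have hvS : v ∈ S := Submodule.mem_span_singleton_self v
    rw [hS] at hvS
    exact hv ((Submodule.mem_bot k).mp hvS)
  · have h1 : Module.finrank k (k ∙ v) = 1 := finrank_span_singleton hv
    have h2 : (k ∙ v : Submodule k (Fin 2 → k)) = ⊤ := congrArg Subrepresentation.toSubmodule hS
    rw [h2, finrank_top, Module.finrank_fin_fun] at h1
    exact absurd h1 (by norm_num)

/-! ### Characteristic two: central commutators are trivial -/

/-- In characteristic `2`, a central element of `GL₂(k)` of determinant `1` is trivial
(it is a scalar `λ` with `λ² = 1`, i.e. `(λ − 1)² = 0`). [folklore] -/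
theorem eq_one_of_mem_center_of_det_eq_one [CharP k 2] {z : GL (Fin 2) k}
    (hz : z ∈ Subgroup.center (GL (Fin 2) k)) (hdet : Matrix.GeneralLinearGroup.det z = 1) :
    z = 1 := by
  rw [Matrix.GeneralLinearGroup.center_eq_range_scalar] at hz
  obtain ⟨u, rfl⟩ := hz
  rw [Matrix.GeneralLinearGroup.det_scalar, Fintype.card_fin] at hdet
  have hu : (u : k) ^ 2 = 1 := by
    have := congrArg Units.val hdet
    simpa using this
  have h2 : (2 : k) = 0 := by
    have := CharP.cast_eq_zero k 2
    simpa using this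
  have h3 : ((u : k) - 1) ^ 2 = 0 := by linear_combination hu - ((u : k) - 1) * h2
  have h4 : (u : k) = 1 := by
    rw [← sub_eq_zero]
    exact (pow_eq_zero_iff two_ne_zero).mp h3
  have : u = 1 := Units.ext h4
  rw [this, map_one]

/-- **In characteristic `2`, two elements of `GL₂(k)` with central commutator commute.**
[folklore] -/
theorem commute_of_commutator_mem_center [CharP k 2] {x y : GL (Fin 2) k}
    (h : x * y * x⁻¹ * y⁻¹ ∈ Subgroup.center (GL (Fin 2) k)) : x * y = y * x := by
  have hdet : Matrix.GeneralLinearGroup.det (x * y * x⁻¹ * y⁻¹) = 1 := by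
    rw [map_mul, map_mul, map_mul, map_inv, map_inv,
      mul_comm (Matrix.GeneralLinearGroup.det x) (Matrix.GeneralLinearGroup.det y),
      mul_inv_cancel_right, mul_inv_cancel]
  have h1 := eq_one_of_mem_center_of_det_eq_one h hdet
  calc x * y = x * y * x⁻¹ * y⁻¹ * (y * x) := by group
    _ = y * x := by rw [h1, one_mul]

end SolvableCharTwo

/-! ### The theorem -/

open SolvableCharTwo in
/-- **Finite solvable subgroups of `GL₂(k)` without a common eigenline, `k` algebraically closed
of characteristic `2`, have dihedral projective image `D_m`, `m ≥ 2`** (Khare–Wintenberger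
2009, Lemma 6.1, there for `k = 𝔽̄₂` and via Dickson's theorem; proved here directly for every
algebraically closed `k` of characteristic `2`, see the module docstring: the last non-scalar
term of the derived series is abelian because central commutators are trivial in characteristic
`2`, its two common eigenlines are permuted by `Γ`, and a monomial group has projective image
"cyclic ∪ involutions"). [cite: KhareWintenberger2009, Lemma 6.1] -/
theorem exists_mulEquiv_dihedralGroup_of_isSolvable_charTwo {k : Type*} [Field k]
    [IsAlgClosed k] [CharP k 2] (Γ : Subgroup (GL (Fin 2) k)) [Finite Γ] (hsol : IsSolvable Γ)
    (hirr : ∀ (v : Fin 2 → k) (hv : v ≠ 0), ∃ g ∈ Γ, g ∉ eigenvectorStabilizer v hv) :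
    ∃ m : ℕ, 2 ≤ m ∧ Nonempty (Γ.map Matrix.ProjGenLinGroup.mk ≃* DihedralGroup m) := by
  classical
  -- the scalar elements of `Γ`, and the last term of the derived series not inside them
  let C : Subgroup Γ := (Subgroup.center (GL (Fin 2) k)).comap Γ.subtype
  have hCmem : ∀ x : Γ, x ∈ C ↔ (x : GL (Fin 2) k) ∈ Subgroup.center (GL (Fin 2) k) :=
    fun x => Iff.rfl
  obtain ⟨d, hd⟩ := hsol.solvable
  have hex : ∃ n, derivedSeries Γ n ≤ C := ⟨d, by rw [hd]; exact bot_le⟩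
  have hj0 : ¬derivedSeries Γ 0 ≤ C := by
    intro h
    rw [derivedSeries_zero] at h
    obtain ⟨g, hg, hgn⟩ := hirr 1 one_ne_zero
    have hc : (⟨g, hg⟩ : Γ) ∈ C := h (Subgroup.mem_top _)
    rw [hCmem, Matrix.GeneralLinearGroup.center_eq_range_scalar] at hc
    obtain ⟨u, hu⟩ := hc
    have hu' : Matrix.GeneralLinearGroup.scalar (Fin 2) u = g := hu
    exact hgn (hu' ▸ scalar_mem_eigenvectorStabilizer _ _ u)
  have hjne : Nat.find hex ≠ 0 := by
    intro h0
    have := Nat.find_spec hex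
    rw [h0] at this
    exact hj0 this
  obtain ⟨j, hj⟩ : ∃ j, Nat.find hex = j + 1 := ⟨Nat.find hex - 1, by omega⟩
  set N : Subgroup Γ := derivedSeries Γ j with hN
  have hNC : ⁅N, N⁆ ≤ C := by
    have := Nat.find_spec hex
    rwa [hj, derivedSeries_succ] at this
  have hNnot : ¬N ≤ C := Nat.find_min hex (by omega : j < Nat.find hex)
  have hNnormal : N.Normal := derivedSeries_normal Γ j
  -- its image `N'` in `GL₂(k)`: commutative (char 2), normalised by `Γ`, with a non-scalar `x₀`
  let N' : Subgroup (GL (Fin 2) k) := N.map Γ.subtype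
  have hN'mem : ∀ z : GL (Fin 2) k, z ∈ N' ↔ ∃ x ∈ N, Γ.subtype x = z := fun z =>
    Subgroup.mem_map
  have hN'comm : ∀ x ∈ N', ∀ y ∈ N', x * y = y * x := by
    intro x' hx' y' hy'
    obtain ⟨x, hx, rfl⟩ := (hN'mem _).mp hx'
    obtain ⟨y, hy, rfl⟩ := (hN'mem _).mp hy'
    have hc := (hCmem _).mp (hNC (Subgroup.commutator_mem_commutator hx hy))
    simp only [commutatorElement_def, Subgroup.coe_mul, InvMemClass.coe_inv] at hc
    exact commute_of_commutator_mem_center hc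
  have hN'normal : ∀ g ∈ Γ, ∀ y ∈ N', g * y * g⁻¹ ∈ N' := by
    intro g hg y' hy'
    obtain ⟨y, hy, rfl⟩ := (hN'mem _).mp hy'
    exact (hN'mem _).mpr ⟨_, hNnormal.conj_mem y hy ⟨g, hg⟩, rfl⟩
  obtain ⟨x₀', hx₀N, hx₀C⟩ := SetLike.not_le_iff_exists.mp hNnot
  rw [hCmem] at hx₀C
  have hx₀N' : (x₀' : GL (Fin 2) k) ∈ N' := (hN'mem _).mpr ⟨x₀', hx₀N, rfl⟩
  -- an eigenvector `v` of `x₀`; its eigenspace is the line `kv`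
  obtain ⟨c, hc⟩ := Module.End.exists_eigenvalue
    (Matrix.toLin' ((x₀' : GL (Fin 2) k) : Matrix (Fin 2) (Fin 2) k))
  obtain ⟨v, hv⟩ := hc.exists_hasEigenvector
  have hv0 : v ≠ 0 := hv.2
  have hMv : ((x₀' : GL (Fin 2) k) : Matrix (Fin 2) (Fin 2) k) *ᵥ v = c • v := by
    simpa [Matrix.toLin'_apply] using hv.apply_eq_smul
  have hline : ∀ u : Fin 2 → k,
      ((x₀' : GL (Fin 2) k) : Matrix (Fin 2) (Fin 2) k) *ᵥ u = c • u → ∃ α : k, u = α • v := by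
    intro u hu
    by_contra hnot
    exact hx₀C (mem_center_of_mulVec_eq_smul (linearIndependent_pair_of_not_mem_line hv0 hnot)
      hMv hu)
  -- `v` is a common eigenvector of `N'`, and `Γ` maps common eigenvectors to common eigenvectors
  have hvN : ∀ y ∈ N', ∃ a : k, (y : Matrix (Fin 2) (Fin 2) k) *ᵥ v = a • v := by
    intro y hy
    apply hline
    rw [Matrix.mulVec_mulVec, ← Matrix.GeneralLinearGroup.coe_mul, ← hN'comm y hy _ hx₀N',
      Matrix.GeneralLinearGroup.coe_mul, ← Matrix.mulVec_mulVec, hMv, Matrix.mulVec_smul]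
  have htrans : ∀ u : Fin 2 → k, (∀ y ∈ N', ∃ a : k, (y : Matrix (Fin 2) (Fin 2) k) *ᵥ u = a • u) →
      ∀ g ∈ Γ, ∀ y ∈ N', ∃ a : k, (y : Matrix (Fin 2) (Fin 2) k) *ᵥ
        ((g : Matrix (Fin 2) (Fin 2) k) *ᵥ u) = a • ((g : Matrix (Fin 2) (Fin 2) k) *ᵥ u) := by
    intro u hu g hg y hy
    obtain ⟨a, ha⟩ := hu (g⁻¹ * y * g⁻¹⁻¹) (hN'normal g⁻¹ (Γ.inv_mem hg) y hy)
    rw [inv_inv] at ha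
    refine ⟨a, ?_⟩
    have hyg : y * g = g * (g⁻¹ * y * g) := by group
    rw [Matrix.mulVec_mulVec, ← Matrix.GeneralLinearGroup.coe_mul, hyg,
      Matrix.GeneralLinearGroup.coe_mul, ← Matrix.mulVec_mulVec, ha, Matrix.mulVec_smul]
  -- a second common eigenline `kw`, `w = h₀ v` for some `h₀ ∈ Γ` moving the line `kv`
  obtain ⟨h₀, hh₀Γ, hh₀⟩ := hirr v hv0
  rw [mem_eigenvectorStabilizer_iff] at hh₀
  set w : Fin 2 → k := (h₀ : Matrix (Fin 2) (Fin 2) k) *ᵥ v with hw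
  have hwline : ¬∃ α : k, w = α • v := hh₀
  have hvw : LinearIndependent k ![v, w] := linearIndependent_pair_of_not_mem_line hv0 hwline
  have hw0 : w ≠ 0 := by simpa using hvw.ne_zero 1
  have hwN : ∀ y ∈ N', ∃ a : k, (y : Matrix (Fin 2) (Fin 2) k) *ᵥ w = a • w :=
    htrans v hvN h₀ hh₀Γ
  obtain ⟨c', hc'⟩ := hwN _ hx₀N'
  have hcc : c ≠ c' := by
    intro hcc
    apply hwline
    apply hline w
    rw [hcc]
    exact hc'
  -- every `g ∈ Γ` preserves both lines or swaps them
  have hdich : ∀ g ∈ Γ,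
      ((∃ a : k, (g : Matrix (Fin 2) (Fin 2) k) *ᵥ v = a • v) ∧
          ∃ b : k, (g : Matrix (Fin 2) (Fin 2) k) *ᵥ w = b • w) ∨
        ((∃ a : k, (g : Matrix (Fin 2) (Fin 2) k) *ᵥ v = a • w) ∧
          ∃ b : k, (g : Matrix (Fin 2) (Fin 2) k) *ᵥ w = b • v) := by
    intro g hg
    obtain ⟨μ, hμ⟩ := htrans v hvN g hg _ hx₀N'
    obtain ⟨μ', hμ'⟩ := htrans w hwN g hg _ hx₀N'
    have h1 := mem_line_or_of_eigenvector hvw hMv hc' hcc hμ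
    have h2 := mem_line_or_of_eigenvector hvw hMv hc' hcc hμ'
    have hind := linearIndependent_pair_mulVec hvw g
    rcases h1 with ⟨α, hα⟩ | ⟨β, hβ⟩ <;> rcases h2 with ⟨α', hα'⟩ | ⟨β', hβ'⟩
    · rw [hα, hα'] at hind
      exact absurd hind (not_linearIndependent_pair_smul_smul v α α')
    · exact Or.inl ⟨⟨α, hα⟩, ⟨β', hβ'⟩⟩
    · exact Or.inr ⟨⟨β, hβ⟩, ⟨α', hα'⟩⟩
    · rw [hβ, hβ'] at hind
      exact absurd hind (not_linearIndependent_pair_smul_smul w β β')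
  -- the line-preserving subgroup `D₀` and its two key properties inside `Γ`
  let D₀ : Subgroup (GL (Fin 2) k) := eigenvectorStabilizer v hv0 ⊓ eigenvectorStabilizer w hw0
  have hD₀mem : ∀ g : GL (Fin 2) k, g ∈ D₀ ↔
      (∃ a : k, (g : Matrix (Fin 2) (Fin 2) k) *ᵥ v = a • v) ∧
        ∃ b : k, (g : Matrix (Fin 2) (Fin 2) k) *ᵥ w = b • w := fun g => Subgroup.mem_inf
  have hswap : ∀ g ∈ Γ, g ∉ D₀ →
      (∃ a : k, (g : Matrix (Fin 2) (Fin 2) k) *ᵥ v = a • w) ∧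
        ∃ b : k, (g : Matrix (Fin 2) (Fin 2) k) *ᵥ w = b • v := by
    intro g hg hgD
    rcases hdich g hg with h | h
    · exact absurd ((hD₀mem g).mpr h) hgD
    · exact h
  -- (P1) a line-swapping element has scalar square
  have hP1 : ∀ g ∈ Γ, g ∉ D₀ → g * g ∈ Subgroup.center (GL (Fin 2) k) := by
    intro g hg hgD
    obtain ⟨⟨a, ha⟩, ⟨b, hb⟩⟩ := hswap g hg hgD
    refine mem_center_of_mulVec_eq_smul hvw (c := a * b) ?_ ?_
    · rw [Matrix.GeneralLinearGroup.coe_mul, ← Matrix.mulVec_mulVec, ha, Matrix.mulVec_smul, hb,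
        smul_smul]
    · rw [Matrix.GeneralLinearGroup.coe_mul, ← Matrix.mulVec_mulVec, hb, Matrix.mulVec_smul, ha,
        smul_smul, mul_comm]
  -- (P2) the product of two line-swapping elements preserves the lines
  have hP2 : ∀ g₁ ∈ Γ, g₁ ∉ D₀ → ∀ g₂ ∈ Γ, g₂ ∉ D₀ → g₁ * g₂ ∈ D₀ := by
    intro g₁ hg₁ hg₁D g₂ hg₂ hg₂D
    obtain ⟨⟨a₁, ha₁⟩, ⟨b₁, hb₁⟩⟩ := hswap g₁ hg₁ hg₁D
    obtain ⟨⟨a₂, ha₂⟩, ⟨b₂, hb₂⟩⟩ := hswap g₂ hg₂ hg₂D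
    rw [hD₀mem]
    refine ⟨⟨a₂ * b₁, ?_⟩, ⟨b₂ * a₁, ?_⟩⟩
    · rw [Matrix.GeneralLinearGroup.coe_mul, ← Matrix.mulVec_mulVec, ha₂, Matrix.mulVec_smul, hb₁,
        smul_smul]
    · rw [Matrix.GeneralLinearGroup.coe_mul, ← Matrix.mulVec_mulVec, hb₂, Matrix.mulVec_smul, ha₁,
        smul_smul]
  -- scalars preserve the lines
  have hCD₀ : Subgroup.center (GL (Fin 2) k) ≤ D₀ := by
    intro z hz
    rw [Matrix.GeneralLinearGroup.center_eq_range_scalar] at hz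
    obtain ⟨u, rfl⟩ := hz
    exact ⟨scalar_mem_eigenvectorStabilizer v hv0 u, scalar_mem_eigenvectorStabilizer w hw0 u⟩
  have hh₀D : h₀ ∉ D₀ := fun h => hwline ((hD₀mem h₀).mp h).1
  have hx₀D : (x₀' : GL (Fin 2) k) ∈ D₀ := (hD₀mem _).mpr ⟨⟨c, hMv⟩, ⟨c', hc'⟩⟩
  -- the ratio character on `Γ ⊓ D₀`; its image is a finite subgroup of `kˣ`, hence cyclic
  let DΓ : Subgroup (GL (Fin 2) k) := Γ ⊓ D₀
  haveI : Finite DΓ :=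
    Finite.of_injective (Subgroup.inclusion (inf_le_left : DΓ ≤ Γ)) (Subgroup.inclusion_injective _)
  -- the two eigenvalue functions on `DΓ` and their ratio `ψ : DΓ →* kˣ`
  have hev : ∀ t : DΓ, ∃ a : k, ((t : GL (Fin 2) k) : Matrix (Fin 2) (Fin 2) k) *ᵥ v = a • v :=
    fun t => ((hD₀mem _).mp (Subgroup.mem_inf.mp t.2).2).1
  have hew : ∀ t : DΓ, ∃ b : k, ((t : GL (Fin 2) k) : Matrix (Fin 2) (Fin 2) k) *ᵥ w = b • w :=
    fun t => ((hD₀mem _).mp (Subgroup.mem_inf.mp t.2).2).2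
  choose ea hea using hev
  choose eb heb using hew
  have hea0 : ∀ t, ea t ≠ 0 := fun t => eigenvalue_ne_zero hv0 (hea t)
  have heb0 : ∀ t, eb t ≠ 0 := fun t => eigenvalue_ne_zero hw0 (heb t)
  have hea_mul : ∀ t t' : DΓ, ea (t * t') = ea t * ea t' := by
    intro t t'
    apply smul_left_injective k hv0
    change ea (t * t') • v = (ea t * ea t') • v
    rw [← hea (t * t'), Subgroup.coe_mul, Units.val_mul, ← Matrix.mulVec_mulVec, hea t',
      Matrix.mulVec_smul, hea t, smul_smul, mul_comm]
  have heb_mul : ∀ t t' : DΓ, eb (t * t') = eb t * eb t' := by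
    intro t t'
    apply smul_left_injective k hw0
    change eb (t * t') • w = (eb t * eb t') • w
    rw [← heb (t * t'), Subgroup.coe_mul, Units.val_mul, ← Matrix.mulVec_mulVec, heb t',
      Matrix.mulVec_smul, heb t, smul_smul, mul_comm]
  let ψ : DΓ →* kˣ := MonoidHom.mk'
    (fun t => Units.mk0 (ea t / eb t) (div_ne_zero (hea0 t) (heb0 t)))
    (by
      intro t t'
      ext
      simp only [Units.val_mk0, Units.val_mul]
      rw [hea_mul, heb_mul, mul_div_mul_comm])
  have hψ : ∀ t, (ψ t : k) = ea t / eb t := fun t => rfl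
  -- its kernel consists of scalars
  have hψker : ∀ t : DΓ, ψ t = 1 → (t : GL (Fin 2) k) ∈ Subgroup.center (GL (Fin 2) k) := by
    intro t ht
    have h' : ea t / eb t = 1 := by rw [← hψ, ht, Units.val_one]
    have heq : ea t = eb t := (div_eq_one_iff_eq (heb0 t)).mp h'
    refine mem_center_of_mulVec_eq_smul hvw (hea t) ?_
    rw [heq]
    exact heb t
  haveI : Finite ψ.range := Finite.of_surjective ψ.rangeRestrict ψ.rangeRestrict_surjective
  obtain ⟨γ, hγ⟩ := IsCyclic.exists_generator (α := ψ.range)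
  obtain ⟨t₀, ht₀⟩ := γ.2
  -- every element of `Γ ⊓ D₀` is a power of `t₀` up to a scalar
  let π : GL (Fin 2) k →* PGL(Fin 2, k) := Matrix.ProjGenLinGroup.mk
  have hkey : ∀ t : DΓ, ∃ z : ℤ, π (t : GL (Fin 2) k) = π (t₀ : GL (Fin 2) k) ^ z := by
    intro t
    obtain ⟨z, hz⟩ := Subgroup.mem_zpowers_iff.mp (hγ ⟨ψ t, t, rfl⟩)
    have h1 : ψ (t₀ ^ z) = ψ t := by
      rw [map_zpow, ht₀, ← Subgroup.coe_zpow, hz]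
    have h2 : ψ (t * (t₀ ^ z)⁻¹) = 1 := by rw [map_mul, map_inv, h1, mul_inv_cancel]
    have h3 := Matrix.ProjGenLinGroup.mk_eq_one.mpr (hψker _ h2)
    refine ⟨z, ?_⟩
    have h4 : π ((t : DΓ) : GL (Fin 2) k) * (π ((t₀ : DΓ) : GL (Fin 2) k) ^ z)⁻¹ = 1 := by
      rw [← map_zpow, ← map_inv, ← map_mul]
      exact_mod_cast h3
    exact mul_inv_eq_one.mp h4
  -- the projective image and its two generators
  let Γbar : Subgroup PGL(Fin 2, k) := Γ.map π
  haveI : Finite Γbar := Finite.of_surjective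
    (fun g : Γ => (⟨π g, Subgroup.mem_map_of_mem π g.2⟩ : Γbar))
    (by rintro ⟨_, g, hg, rfl⟩; exact ⟨⟨g, hg⟩, rfl⟩)
  let abar : Γbar := ⟨π (t₀ : GL (Fin 2) k), Subgroup.mem_map_of_mem π t₀.2.1⟩
  let sbar : Γbar := ⟨π h₀, Subgroup.mem_map_of_mem π hh₀Γ⟩
  -- elements of `Γ ⊓ D₀` map into `⟨abar⟩`
  have hmemA : ∀ g (hg : g ∈ Γ), g ∈ D₀ →
      (⟨π g, Subgroup.mem_map_of_mem π hg⟩ : Γbar) ∈ Subgroup.zpowers abar := by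
    intro g hg hgD
    obtain ⟨z, hz⟩ := hkey ⟨g, hg, hgD⟩
    exact Subgroup.mem_zpowers_iff.mpr ⟨z, Subtype.ext (by push_cast; exact hz.symm)⟩
  -- (i) `sbar ∉ ⟨abar⟩`
  have hs : sbar ∉ Subgroup.zpowers abar := by
    intro h
    obtain ⟨z, hz⟩ := Subgroup.mem_zpowers_iff.mp h
    have hz' : π ((t₀ : GL (Fin 2) k) ^ z) = π h₀ := by
      have h1 := congrArg Subtype.val hz
      simp only [Subgroup.coe_zpow] at h1
      rw [map_zpow]
      exact h1
    obtain ⟨c₀, hc₀, hc₀'⟩ := Matrix.ProjGenLinGroup.mk_eq_mk_iff'.mp hz'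
    apply hh₀D
    rw [← hc₀']
    exact D₀.mul_mem (D₀.zpow_mem t₀.2.2 z) (hCD₀ hc₀)
  -- (ii) `sbar² = 1`
  have hs2 : sbar * sbar = 1 := by
    refine Subtype.ext ?_
    push_cast
    rw [← map_mul]
    exact Matrix.ProjGenLinGroup.mk_eq_one.mpr (hP1 h₀ hh₀Γ hh₀D)
  -- (iii) `sbar abar sbar⁻¹ = abar⁻¹`
  have hsa : sbar * abar * sbar⁻¹ = abar⁻¹ := by
    have ht₀D : h₀ * (t₀ : GL (Fin 2) k) ∉ D₀ := fun h =>
      hh₀D (by simpa using D₀.mul_mem h (D₀.inv_mem t₀.2.2))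
    have h1 : (sbar * abar) * (sbar * abar) = 1 := by
      refine Subtype.ext ?_
      push_cast
      rw [← map_mul, ← map_mul]
      exact Matrix.ProjGenLinGroup.mk_eq_one.mpr (hP1 _ (Γ.mul_mem hh₀Γ t₀.2.1) ht₀D)
    have hsinv : sbar⁻¹ = sbar := inv_eq_of_mul_eq_one_right hs2
    rw [hsinv]
    have h2 : sbar * abar * sbar * abar = 1 := by simpa [mul_assoc] using h1
    exact eq_inv_of_mul_eq_one_left h2
  -- (iv) `Γbar = ⟨abar⟩ ∪ sbar⟨abar⟩`
  have hcover : ∀ x : Γbar, x ∈ Subgroup.zpowers abar ∨ sbar⁻¹ * x ∈ Subgroup.zpowers abar := by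
    rintro ⟨_, g, hg, rfl⟩
    by_cases hgD : g ∈ D₀
    · exact Or.inl (hmemA g hg hgD)
    · right
      have hh₀inv : h₀⁻¹ ∉ D₀ := fun h => hh₀D (by simpa using D₀.inv_mem h)
      have hmem := hmemA (h₀⁻¹ * g) (Γ.mul_mem (Γ.inv_mem hh₀Γ) hg)
        (hP2 _ (Γ.inv_mem hh₀Γ) hh₀inv g hg hgD)
      convert hmem using 1
      refine Subtype.ext ?_
      push_cast
      rw [map_mul, map_inv]
  -- (v) `ord abar ≥ 2`, since `x̄₀ ∈ ⟨abar⟩` is non-trivial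
  have hm : 2 ≤ orderOf abar := by
    have hx₀bar : (⟨π (x₀' : GL (Fin 2) k), Subgroup.mem_map_of_mem π x₀'.2⟩ : Γbar) ≠ 1 := by
      intro h
      have := congrArg Subtype.val h
      push_cast at this
      exact hx₀C (Matrix.ProjGenLinGroup.mk_eq_one.mp this)
    have habar : abar ≠ 1 := by
      intro h1
      apply hx₀bar
      have := hmemA (x₀' : GL (Fin 2) k) x₀'.2 hx₀D
      rw [h1, Subgroup.zpowers_one_eq_bot, Subgroup.mem_bot] at this
      exact this
    have h0 : orderOf abar ≠ 0 := (orderOf_pos abar).ne'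
    have h1 : orderOf abar ≠ 1 := fun h => habar (orderOf_eq_one_iff.mp h)
    omega
  exact ⟨orderOf abar, hm, nonempty_mulEquiv_dihedralGroup hs hs2 hsa hcover⟩

open SolvableCharTwo in
/-- **Solvable irreducible two-dimensional representations in characteristic `2` are of dihedral
type**: for `ρ : G →* GL₂(k)`, `k` algebraically closed of characteristic `2`, with finite
solvable image and irreducible standard representation on `k²`, the projective image is
`D_m` for some `m ≥ 2` (Khare–Wintenberger 2009, Lemma 6.1, for `k = 𝔽̄₂`; any algebraically
closed `k` of characteristic `2` here). [cite: KhareWintenberger2009, Lemma 6.1] -/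
theorem isDihedralType_of_isSolvable_charTwo {k : Type*} [Field k] [IsAlgClosed k] [CharP k 2]
    {G : Type*} [Group G] (ρ : G →* GL (Fin 2) k) [Finite ρ.range] (hsol : IsSolvable ρ.range)
    (hirr : (toStdRepresentation ρ).IsIrreducible) : IsDihedralType ρ := by
  obtain ⟨m, hm, ⟨e⟩⟩ := exists_mulEquiv_dihedralGroup_of_isSolvable_charTwo ρ.range hsol
    (fun v hv => by
      obtain ⟨g, hg⟩ := exists_not_mem_eigenvectorStabilizer ρ hirr v hv
      exact ⟨ρ g, ⟨g, rfl⟩, hg⟩)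
  exact ⟨m, hm, ⟨(MulEquiv.subgroupCongr (projectiveImage_eq_map_range ρ)).trans e⟩⟩

end Literature.NumberTheory.GaloisRepresentations

namespace Literature.NumberTheory.GaloisRepresentations.KhareWintenberger2009

/-- **Khare–Wintenberger 2009, Lemma 6.1.** *Let `G` be a finite, solvable subgroup of
`GL₂(𝔽̄₂)` which acts irreducibly on `𝔽̄₂²`.  Then the projective image of `G` is dihedral.*
Stated for a finite solvable subgroup `G` of `GL₂(k)`, `k` any algebraically closed field of
characteristic `2` (e.g. `𝔽̄₂`), acting irreducibly through its inclusion
(`toStdRepresentation G.subtype`); conclusion `IsDihedralType G.subtype`: the projective image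
is isomorphic to `D_m` for some `m ≥ 2`.  Proved (without Dickson's theorem) by
`isDihedralType_of_isSolvable_charTwo`. [cite: KhareWintenberger2009, Lemma 6.1] -/
theorem lemma_6_1 {k : Type*} [Field k] [IsAlgClosed k] [CharP k 2]
    (G : Subgroup (GL (Fin 2) k)) [Finite G] (hsol : IsSolvable G)
    (hirr : (toStdRepresentation G.subtype).IsIrreducible) : IsDihedralType G.subtype := by
  have e : G.subtype.range ≃* G := MulEquiv.subgroupCongr G.range_subtype
  haveI : Finite G.subtype.range := Finite.of_equiv _ e.toEquiv.symm
  haveI := hsol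
  have hs : IsSolvable G.subtype.range :=
    solvable_of_surjective (f := e.symm.toMonoidHom) e.symm.surjective
  exact isDihedralType_of_isSolvable_charTwo G.subtype hs hirr

end Literature.NumberTheory.GaloisRepresentations.KhareWintenberger2009
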